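import Literature.MathematicalPhysics.QuantumLattice.HubbardHubbardModelNoLROProofs
import Literature.MathematicalPhysics.QuantumLattice.XYOrderProofs
import HarnessLib

/-!
# Koma–Tasaki 1992: no condensation at ANY wavevector — thermal pair and transverse-spin
# structure factors of the two-dimensional Hubbard model are `o(L²)`

Topic `MathematicalPhysics/QuantumLattice` (family `hubbard`, statement hubbard.S11); sibling PROOF
file of `HubbardHubbardModel.lean` / `HubbardHubbardModelNoLROProofs.lean`. The tree's
`koma_tasaki_noLRO_holds` excludes UNIFORM long-range order (`¬ HasTorusLRO`, wavevector `q = 0`: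
Cooper-pair condensation, ferromagnetic transverse order) of the thermal pair and `S⁺S⁻` two-point
functions on `(ℤ/Lℤ)²` at every `T > 0`. Koma–Tasaki's remark after their Theorem is blind to the
wavevector: the uniform power-law DECAY (2)–(4) "rigorously rule[s] out the possibility of the
corresponding condensations of electrons or electron pairs and of the corresponding magnetic
ordering" — i.e. condensation into ANY single mode (η-pairing at `Q = (π,π)`, pair-density waves /
FFLO-type pairing at incommensurate `q`, spiral or stripe-modulated transverse spin order). This
file proves that general form:

* `abs_weightedCorrSum_div_le`, `tendsto_weightedCorrSum_div_of_abs_le_rpow` — the summation lemma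
  behind `not_hasTorusLRO_of_abs_le_rpow`, for ARBITRARY weights `|w_L(x,y)| ≤ 1`: a uniform bound
  `|G_L(x,y)| ≤ C (dist(x,y)+1)^{-f}`, `f > 0`, gives `L^{-2d} Σ_{x,y} w_L(x,y) G_L(x,y) → 0`;
* `hubbard_thermalPairCorr_weightedSum_tendsto_zero`, `hubbard_thermalSpinCorr_weightedSum_tendsto_zero`
  — UNCONDITIONAL (from `koma_tasaki_2d_holds`, `koma_tasaki_magnetic_holds`): for all `t, U, μ`,
  `0 < β` and all weights `|w| ≤ 1`, `L⁻⁴ Σ_{x,y ∈ (ℤ/Lℤ)²} w_L(x,y) G_L(x,y) → 0` for the thermal pair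
  and transverse-spin two-point functions of `hubbardTorusWith 2 L t U μ`;
* `hubbard_thermalPairStructureFactor_tendsto_zero`, `hubbard_thermalSpinStructureFactor_tendsto_zero`
  — the structure factors PER SITE vanish at every, possibly `L`-dependent, momentum `k_L`:
  `L⁻⁴ Σ_{x,y} cos(k_L·(x-y)) G_L(x,y) → 0` (no macroscopic occupation of any pair mode / no
  transverse magnetic Bragg peak at any wavevector, `T > 0`, `d = 2`).

Theorems only: no definition, no named fact, no statement of the tree is changed.
HONEST FRAMING (cell pub-hubbard): ladder R1–R4 with certified numbers; no claim on H/H₀.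

## Source

T. Koma, H. Tasaki, *Decay of superconducting and magnetic correlations in one- and
two-dimensional Hubbard models*, PRL **68** (1992) 3248 = arXiv:cond-mat/9709068, Theorem
eqs. (2)–(4) and the remark after the Theorem (arXiv p. 3).
-/

noncomputable section

namespace Literature.MathematicalPhysics.QuantumLattice

open Matrix Filter Topology Finset Literature.Probability.LatticeModels HubbardHubbardModelProofs
open scoped ComplexOrder

variable {d : ℕ}

/-! ### The weighted summation lemma -/

/-- **Basic estimate.** If `|G_L(x,y)| ≤ C (dist(x,y)+1)^{-f}` (`f ≥ 0`) and `|w_L(x,y)| ≤ 1`, then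
for every cut-off radius `R` and every side `L ≥ 1`,
`|L^{-2d} Σ_{x,y} w_L(x,y) G_L(x,y)| ≤ max(C,0)·((2R+1)^d L^{-d} + (R+1)^{-f})` (row sums by
`sum_abs_le_of_abs_le_rpow`). [cite: KomaTasakiPRL1992, remark after the Theorem] -/
theorem abs_weightedCorrSum_div_le {G w : (L : ℕ) → TorusSite d L → TorusSite d L → ℝ} {C f : ℝ}
    (hf : 0 ≤ f)
    (hG : ∀ (L : ℕ) [NeZero L] (x y : TorusSite d L),
      |G L x y| ≤ C * ((torusDist x y : ℝ) + 1) ^ (-f))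
    (hw : ∀ (L : ℕ) [NeZero L] (x y : TorusSite d L), |w L x y| ≤ 1) (R L : ℕ) [NeZero L] :
    |(∑ x : TorusSite d L, ∑ y : TorusSite d L, w L x y * G L x y) / (L : ℝ) ^ (2 * d)| ≤
      max C 0 * (2 * R + 1 : ℝ) ^ d / (L : ℝ) ^ d + max C 0 * ((R : ℝ) + 1) ^ (-f) := by
  classical
  set C' : ℝ := max C 0 with hC'
  have hL0 : (0 : ℝ) < (L : ℝ) := by exact_mod_cast Nat.pos_of_ne_zero (NeZero.ne L)
  have hLpos : (0 : ℝ) < (L : ℝ) ^ d := pow_pos hL0 d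
  have hL2pos : (0 : ℝ) < (L : ℝ) ^ (2 * d) := pow_pos hL0 _
  set B : ℝ := (2 * R + 1 : ℝ) ^ d + (L : ℝ) ^ d * ((R : ℝ) + 1) ^ (-f) with hB
  have hwG : ∀ (x y : TorusSite d L), |w L x y * G L x y| ≤ |G L x y| := by
    intro x y
    rw [abs_mul]
    exact mul_le_of_le_one_left (abs_nonneg _) (hw L x y)
  have hrow : ∀ x : TorusSite d L, |∑ y, w L x y * G L x y| ≤ C' * B := by
    intro x
    calc |∑ y, w L x y * G L x y| ≤ ∑ y, |w L x y * G L x y| := Finset.abs_sum_le_sum_abs _ _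
      _ ≤ ∑ y, |G L x y| := sum_le_sum fun y _ => hwG x y
      _ ≤ C' * B := sum_abs_le_of_abs_le_rpow hf (fun x y => hG L x y) x R
  have hS : |∑ x : TorusSite d L, ∑ y, w L x y * G L x y| ≤ (L : ℝ) ^ d * (C' * B) := by
    calc |∑ x : TorusSite d L, ∑ y, w L x y * G L x y|
        ≤ ∑ x : TorusSite d L, |∑ y, w L x y * G L x y| := Finset.abs_sum_le_sum_abs _ _
      _ ≤ Finset.card (univ : Finset (TorusSite d L)) • (C' * B) :=
          Finset.sum_le_card_nsmul _ _ _ fun x _ => hrow x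
      _ = (L : ℝ) ^ d * (C' * B) := by
          rw [nsmul_eq_mul, Finset.card_univ, Fintype.card_pi]
          simp [ZMod.card, Finset.prod_const]
  rw [abs_div, abs_of_nonneg hL2pos.le, div_le_iff₀ hL2pos]
  calc |∑ x : TorusSite d L, ∑ y, w L x y * G L x y| ≤ (L : ℝ) ^ d * (C' * B) := hS
    _ = (C' * (2 * R + 1 : ℝ) ^ d / (L : ℝ) ^ d + C' * ((R : ℝ) + 1) ^ (-f)) * (L : ℝ) ^ (2 * d) := by
        rw [hB, pow_mul, sq]
        field_simp
        ring

/-- **Uniform power-law decay kills every weighted average** (`d ≥ 1`): if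
`|G_L(x,y)| ≤ C (dist(x,y)+1)^{-f}` with `f > 0` uniformly in `L ≥ 1`, then for ALL weights
`|w_L(x,y)| ≤ 1` — signs `(-1)^{x+y}`, phases `cos(k_L·(x-y))` at any `L`-dependent momentum, window
functions — `L^{-2d} Σ_{x,y ∈ (ℤ/Lℤ)^d} w_L(x,y) G_L(x,y) → 0` (indexed by `L + 1 ≥ 1`). Choose `R` with
`max(C,0)(R+1)^{-f} < ε/2`, then `L` large. [cite: KomaTasakiPRL1992, remark after the Theorem]
[cite: FriedliVelenik2017, §3.7.2 Definition 3.27 and §3.10.3] -/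
theorem tendsto_weightedCorrSum_div_of_abs_le_rpow (hd : d ≠ 0)
    {G w : (L : ℕ) → TorusSite d L → TorusSite d L → ℝ} {C f : ℝ} (hf : 0 < f)
    (hG : ∀ (L : ℕ) [NeZero L] (x y : TorusSite d L),
      |G L x y| ≤ C * ((torusDist x y : ℝ) + 1) ^ (-f))
    (hw : ∀ (L : ℕ) [NeZero L] (x y : TorusSite d L), |w L x y| ≤ 1) :
    Tendsto (fun L : ℕ => (∑ x : TorusSite d (L + 1), ∑ y : TorusSite d (L + 1),
        w (L + 1) x y * G (L + 1) x y) / ((L + 1 : ℕ) : ℝ) ^ (2 * d)) atTop (𝓝 0) := by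
  set C' : ℝ := max C 0 with hC'
  rw [Metric.tendsto_atTop]
  intro ε hε
  have h1 : Tendsto (fun R : ℕ => C' * ((R : ℝ) + 1) ^ (-f)) atTop (𝓝 0) := by
    have := ((tendsto_rpow_neg_atTop hf).comp
      (tendsto_atTop_add_const_right atTop (1 : ℝ) tendsto_natCast_atTop_atTop)).const_mul C'
    simpa using this
  obtain ⟨R, hR⟩ := (h1.eventually (eventually_lt_nhds (half_pos hε))).exists
  have hL : Tendsto (fun L : ℕ => ((L + 1 : ℕ) : ℝ)) atTop atTop :=
    tendsto_natCast_atTop_atTop.comp (tendsto_add_atTop_nat 1)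
  have h2 : Tendsto (fun L : ℕ => C' * (2 * R + 1 : ℝ) ^ d / ((L + 1 : ℕ) : ℝ) ^ d) atTop (𝓝 0) :=
    tendsto_const_nhds.div_atTop ((tendsto_pow_atTop hd).comp hL)
  obtain ⟨N, hN⟩ := eventually_atTop.1 (h2.eventually (eventually_lt_nhds (half_pos hε)))
  refine ⟨N, fun L hLN => ?_⟩
  rw [Real.dist_0_eq_abs]
  calc |(∑ x : TorusSite d (L + 1), ∑ y, w (L + 1) x y * G (L + 1) x y) / ((L + 1 : ℕ) : ℝ) ^ (2 * d)|
      ≤ C' * (2 * R + 1 : ℝ) ^ d / ((L + 1 : ℕ) : ℝ) ^ d + C' * ((R : ℝ) + 1) ^ (-f) :=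
        abs_weightedCorrSum_div_le hf.le hG hw R (L + 1)
    _ < ε / 2 + ε / 2 := add_lt_add (hN L hLN) hR
    _ = ε := add_halves ε

/-! ### The two-dimensional Hubbard model at `T > 0` -/

/-- **No weighted pair order at `T > 0`, `d = 2`** (UNCONDITIONAL): for all `t, U, μ`, every
`0 < β` and all weights `|w_L(x,y)| ≤ 1`, the thermal on-site pair two-point function
`G_L(x,y) = Re⟨c†_{x↑}c†_{x↓}c_{y↓}c_{y↑}⟩_{β,L}` of `hubbardTorusWith 2 L t U μ` satisfies
`L⁻⁴ Σ_{x,y} w_L(x,y) G_L(x,y) → 0`; from `koma_tasaki_2d_holds`. Koma–Tasaki, PRL 68 (1992) 3248,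
Theorem eq. (2) and the remark after it ("rule out the possibility of the corresponding
condensations of … electron pairs"). [cite: KomaTasakiPRL1992, Theorem eq. (2) and remark after the Theorem (arXiv p. 3)] -/
theorem hubbard_thermalPairCorr_weightedSum_tendsto_zero (t U μ β : ℝ) (hβ : 0 < β)
    {w : (L : ℕ) → TorusSite 2 L → TorusSite 2 L → ℝ}
    (hw : ∀ (L : ℕ) [NeZero L] (x y : TorusSite 2 L), |w L x y| ≤ 1) :
    Tendsto (fun L : ℕ => (∑ x : TorusSite 2 (L + 1), ∑ y : TorusSite 2 (L + 1),
        w (L + 1) x y * thermalPairCorr (d := 2) β t U μ (L + 1) x y) / ((L + 1 : ℕ) : ℝ) ^ (2 * 2))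
      atTop (𝓝 0) := by
  obtain ⟨f, hf, C, hC⟩ := koma_tasaki_2d_holds t U μ β hβ
  refine tendsto_weightedCorrSum_div_of_abs_le_rpow two_ne_zero (C := C) hf (fun L _ x y => ?_) hw
  cases L with
  | zero => exact absurd rfl (NeZero.ne 0)
  | succ n => exact (Complex.abs_re_le_norm _).trans (hC (n + 1) x y)

/-- **No weighted transverse-spin order at `T > 0`, `d = 2`** (UNCONDITIONAL): the same for
`G_L(x,y) = Re⟨S⁺_x S⁻_y⟩_{β,L}`; from the `d = 2` half of `koma_tasaki_magnetic_holds`. Koma–Tasaki,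
PRL 68 (1992) 3248, Theorem eq. (4) and the remark after it ("… and of the corresponding magnetic
ordering"). [cite: KomaTasakiPRL1992, Theorem eq. (4) and remark after the Theorem (arXiv p. 3)] -/
theorem hubbard_thermalSpinCorr_weightedSum_tendsto_zero (t U μ β : ℝ) (hβ : 0 < β)
    {w : (L : ℕ) → TorusSite 2 L → TorusSite 2 L → ℝ}
    (hw : ∀ (L : ℕ) [NeZero L] (x y : TorusSite 2 L), |w L x y| ≤ 1) :
    Tendsto (fun L : ℕ => (∑ x : TorusSite 2 (L + 1), ∑ y : TorusSite 2 (L + 1),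
        w (L + 1) x y * thermalSpinCorr (d := 2) β t U μ (L + 1) x y) / ((L + 1 : ℕ) : ℝ) ^ (2 * 2))
      atTop (𝓝 0) := by
  obtain ⟨⟨f, hf, C, hC⟩, -⟩ := koma_tasaki_magnetic_holds t U μ β hβ
  refine tendsto_weightedCorrSum_div_of_abs_le_rpow two_ne_zero (C := C) hf (fun L _ x y => ?_) hw
  cases L with
  | zero => exact absurd rfl (NeZero.ne 0)
  | succ n => exact (Complex.abs_re_le_norm _).trans (hC (n + 1) x y)

/-- **The thermal pair structure factor per site vanishes at EVERY wavevector** (`T > 0`, `d = 2`,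
UNCONDITIONAL): for all `t, U, μ`, `0 < β` and every choice of momenta `k_L ∈ (ℤ/Lℤ)²` (constant,
`(π,π)`, incommensurate, `L`-dependent …),
`L⁻⁴ Σ_{x,y} cos(k_L·(x-y)) Re⟨c†_{x↑}c†_{x↓}c_{y↓}c_{y↑}⟩_{β,L} → 0` — no macroscopic occupation of any
single pair mode (Cooper `k = 0`, η-pairing `k = (π,π)`, pair-density-wave `k ≠ 0`). Koma–Tasaki,
PRL 68 (1992) 3248, remark after the Theorem ("inhibits the condensation of singlet electron pairs
such as the Cooper pairs or the η-pairs"). [cite: KomaTasakiPRL1992, Theorem eq. (2) and remark after the Theorem (arXiv p. 3)] -/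
theorem hubbard_thermalPairStructureFactor_tendsto_zero (t U μ β : ℝ) (hβ : 0 < β)
    (k : (L : ℕ) → TorusSite 2 L) :
    Tendsto (fun L : ℕ => (∑ x : TorusSite 2 (L + 1), ∑ y : TorusSite 2 (L + 1),
        Real.cos (torusPhase (L + 1) (k (L + 1)) (x - y)) * thermalPairCorr (d := 2) β t U μ (L + 1) x y) /
          ((L + 1 : ℕ) : ℝ) ^ (2 * 2)) atTop (𝓝 0) :=
  hubbard_thermalPairCorr_weightedSum_tendsto_zero t U μ β hβ
    (w := fun L x y => Real.cos (torusPhase L (k L) (x - y))) fun _ _ _ _ => Real.abs_cos_le_one _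

/-- **The thermal transverse-spin structure factor per site vanishes at EVERY wavevector**
(`T > 0`, `d = 2`, UNCONDITIONAL): `L⁻⁴ Σ_{x,y} cos(k_L·(x-y)) Re⟨S⁺_x S⁻_y⟩_{β,L} → 0` for every
choice of momenta `k_L` — no ferromagnetic (`k = 0`), Néel (`k = (π,π)`), spiral or stripe-modulated
transverse magnetic Bragg peak. Koma–Tasaki, PRL 68 (1992) 3248, remark after the Theorem.
[cite: KomaTasakiPRL1992, Theorem eq. (4) and remark after the Theorem (arXiv p. 3)] -/
theorem hubbard_thermalSpinStructureFactor_tendsto_zero (t U μ β : ℝ) (hβ : 0 < β)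
    (k : (L : ℕ) → TorusSite 2 L) :
    Tendsto (fun L : ℕ => (∑ x : TorusSite 2 (L + 1), ∑ y : TorusSite 2 (L + 1),
        Real.cos (torusPhase (L + 1) (k (L + 1)) (x - y)) * thermalSpinCorr (d := 2) β t U μ (L + 1) x y) /
          ((L + 1 : ℕ) : ℝ) ^ (2 * 2)) atTop (𝓝 0) :=
  hubbard_thermalSpinCorr_weightedSum_tendsto_zero t U μ β hβ
    (w := fun L x y => Real.cos (torusPhase L (k L) (x - y))) fun _ _ _ _ => Real.abs_cos_le_one _

end Literature.MathematicalPhysics.QuantumLattice
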